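import Literature.MathematicalPhysics.QuantumFieldTheory.Balaban1983to89.B5G183FreeRowSum

/-!
# `Balaban1983to89.B5Eq129CycleWeightedMass` — T. Bałaban, *Propagators and renormalization transformations for lattice gauge theories. I*, Commun. Math.
# Phys. **95** (1984) 17–40 [Balaban1984PropagatorsI] (1.29) p. 23, p. 36 (exponential weights): **THE `cosh`-WEIGHTED MASS OF THE MASSIVE CYCLE KERNEL AND THE
# VOLUME-UNIFORM FORM OF THE WEIGHTED ∇-ROW BRACKETS — on `ℤ∕n`, for `G ≥ 0` solving `t²[(G s − G(s−1)) + (G s − G(s+1))] + μ·G s = δ₀(s)`: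
# `(μ − 2t²(cosh a − 1))·Σ_s cosh(a·d_n(s))·G(s) ≤ 1` (`d_n(s) = min(s, n − s)`), and hence
# `(1 + cosh a)G(0) + 2 sinh a·Σ_{1≤j<⌊n∕2⌋} sinh(aj)G(j) ≤ (1 + e^{−a})G(0) + sinh a·Σ_s cosh(a·d_n(s))G(s) ≤ (1 + e^{−a})G(0) + sinh a ∕ (μ − 2t²(cosh a − 1))`,
# `(1 + e^a)G(0) + 2 sinh a·Σ_{1≤j<⌊n∕2⌋} e^{aj}G(j) ≤ (1 + e^{−a})G(0) + 2 sinh a ∕ (μ − 2t²(cosh a − 1))`** — the brackets of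
# `B5Eq129FreeResolventWeightedGradientRow.weighted_sum_abs_sub_le_cosh` ((W-0)) ∕ `…_exp` ((W-1)) bounded UNIFORMLY IN THE PERIOD `n` by two letters: `G(0)` and the
# OWNER's rate window (at the transversally shifted mass `μ = m − 2(d−1)t²(cosh a − 1)` the denominator is EXACTLY `λ = m − 2d·t²(cosh a − 1)` of
# `B5Eq129CoshSupersolution.weight_supersolution`); storey J (K∇) of the pub-balaban NE9 chain (row L13), the 1-D companion of `B5Eq129FreeResolventWeightedMass`

statement-level skeleton of published theorems with citation tags; proofs where landed; nothing here is a claim about the Yang–Mills mass gap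

CITATION HEADER (lean-in-tree rule).  Audit cell `pub-balaban`, sub-cell `t4`, BINDER row NE9; filed by NE9 crux-team LEAF PROVER 05
(`b2b-balaban-t4-ne9-formalise-leaf-05`, gen 81).  OBJECT: the cycle resolvent equation of [Balaban1984PropagatorsI] (1.29) (one direction of the (FS) stencil, weight `t²`,
mass `μ`, source `δ₀`) and the `cosh` weight of p. 36 on the cycle, as HYPOTHESES ∕ written out; no `def`.  CONTENT: [folklore] (summation by parts on `ℤ∕n`; the fold
`j ↦ ±j` of `[1, ⌊n∕2⌋)` into `ℤ∕n ∖ {0}`; `sinh ≤ cosh`, `e^x = cosh x + sinh x`).  pv15's one-step letter `B5G183FreeRowSum.cosh_circAbs_step` (with `circAbs_val_eq`) USED BY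
NAME — credit theirs; the same step for an arbitrary centre is `B5Eq129CoshWeightFactorLetters.cosh_factor_step`.  Nothing of print is asserted.

WHAT IS PROVED (sorry-free; proof lane — 0 `def`).
* §1 **`cycle_sum_mul_stencil_comm`** (the cycle stencil is symmetric), **`cycle_weighted_mass_le`** — `λ₁·Σ_s w(s)G(s) ≤ w(0)` for ANY weight with
  `λ₁·w ≤ (L₀ + μ)w` and `G ≥ 0` (the 1-D form of `B5Eq129FreeResolventWeightedMass.mul_weighted_sum_le`); **`cycle_mass_eq`** — `μ·Σ_s G(s) = 1`, hence `G(0) ≤ 1∕μ`.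
* §2 `circAbs_val_eq_min'` (`circAbs n (s.val) = min(s, n − s)`), **`cosh_cycleDist_step`**, **`cosh_cycleDist_supersolution`** — `w(s) = cosh(a·min(s, n − s))` has
  `(μ − 2t²(cosh a − 1))·w ≤ (L₀ + μ)w`; **`cosh_weighted_mass_le`** —
  `(μ − 2t²(cosh a − 1))·Σ_s cosh(a·min(s, n−s))·G(s) ≤ 1`.
* §3 **`two_mul_sum_Ico_le`** — for `g ≥ 0`, `G ≥ 0` even: `2·Σ_{j ∈ Ico 1 (n∕2)} g(j)·G(j) ≤ Σ_{s ≠ 0} g(min(s, n−s))·G(s)` (the V-fold).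
* §4 **`cosh_bracket_le`**, **`exp_bracket_le`** — the displayed bounds with `Σ_s cosh(a·d_n(s))G(s)` kept; **`cosh_bracket_le_uniform`**, **`exp_bracket_le_uniform`** —
  with §2 substituted (rate window `2t²(cosh a − 1) < μ`).
HONEST SCOPE.  One cycle, flat stencil; `G ≥ 0` and evenness are displayed (the tree's `B5Eq129FreeResolventCycleComparison` ∕ `…KernelMonotone` supply them); `G(0)` stays a
letter (closed form `B5Eq129FreeResolventCycleProfile.cycle_profile_eq`: `G(0) = (1 + qⁿ)∕((1 − qⁿ)√(μ² + 4μt²))`; crude `G(0) ≤ 1∕μ` here).  ONE input of ONE letter of ONE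
un-opened storey (J) of row L13; NOT the ∇-line of (3.42), NOT Tier P, NOT NE9 (cell pub-balaban: NE9 NOT PRINTED ∕ NOT PROVED; «NE9 ⇐ the named binders»; row WALLED
ON A MODEL (O-NE9-1; #5 UNRULED); spine PROVED 0∕9; rung (B)+1 finite T⁴ — NOT infinite volume, NOT mass gap, NOT BetaPertH, NOT Clay).  HONEST DEPENDENCY: continuum
YM on T⁴ ⇐ BetaPertH ∧ nine spine estimates (0/9 proved); BetaPertH ⇐ (D1) ∧ (D4) ∧ CAP+tail; G-an2-4 gates asym, D1 and NE2/3/4.  NEW file importing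
`B5G183FreeRowSum` only (BUILT; lane-independent); nothing modified.  Net new unproved facts: 0.
-/

noncomputable section

open scoped BigOperators

namespace Literature.MathematicalPhysics.QuantumFieldTheory.Balaban1983to89.B5Eq129CycleWeightedMass

open B4TorusKernel.MultiPeriod (circAbs)
open B5G183FreeRowSum (cosh_circAbs_step circAbs_val_eq)

variable {n : ℕ} [NeZero n]

/-! ## §1 The weighted mass of the cycle kernel against a supersolution weight -/

/-- the cycle stencil is symmetric: `Σ_s w(s)·(L₀G)(s) = Σ_s G(s)·(L₀w)(s)` (summation by parts on `ℤ∕n`). [folklore] [cite: Balaban1984PropagatorsI, (1.29) p.23] -/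
theorem cycle_sum_mul_stencil_comm (t : ℝ) (w G : ZMod n → ℝ) :
    ∑ s, w s * (t ^ 2 * ((G s - G (s - 1)) + (G s - G (s + 1)))) = ∑ s, G s * (t ^ 2 * ((w s - w (s - 1)) + (w s - w (s + 1)))) := by
  have h1 : ∑ s : ZMod n, w s * G (s - 1) = ∑ s : ZMod n, w (s + 1) * G s :=
    (Fintype.sum_equiv (Equiv.addRight 1) (fun s => w (s + 1) * G s) (fun s => w s * G (s - 1))
      (fun s => by simp only [Equiv.coe_addRight, add_sub_cancel_right])).symm
  have h2 : ∑ s : ZMod n, w s * G (s + 1) = ∑ s : ZMod n, w (s - 1) * G s :=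
    (Fintype.sum_equiv (Equiv.subRight 1) (fun s => w (s - 1) * G s) (fun s => w s * G (s + 1))
      (fun s => by simp only [Equiv.subRight_apply, sub_add_cancel])).symm
  have eL : ∑ s, w s * (t ^ 2 * ((G s - G (s - 1)) + (G s - G (s + 1)))) =
      t ^ 2 * (2 * ∑ s, w s * G s - ∑ s, w s * G (s - 1) - ∑ s, w s * G (s + 1)) := by
    rw [Finset.mul_sum, ← Finset.sum_sub_distrib, ← Finset.sum_sub_distrib, Finset.mul_sum]
    exact Finset.sum_congr rfl fun s _ => by ring
  have eR : ∑ s, G s * (t ^ 2 * ((w s - w (s - 1)) + (w s - w (s + 1)))) =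
      t ^ 2 * (2 * ∑ s, w s * G s - ∑ s, w (s - 1) * G s - ∑ s, w (s + 1) * G s) := by
    rw [Finset.mul_sum, ← Finset.sum_sub_distrib, ← Finset.sum_sub_distrib, Finset.mul_sum]
    exact Finset.sum_congr rfl fun s _ => by ring
  rw [eL, eR, h1, h2]
  ring

/-- **THE WEIGHTED MASS OF THE CYCLE KERNEL**: if `G ≥ 0` solves `t²[(G s − G(s−1)) + (G s − G(s+1))] + μ·G s = δ₀(s)` and the weight `w` is a `λ₁`-supersolution
(`λ₁·w ≤ (L₀ + μ)w`), then `λ₁·Σ_s w(s)G(s) ≤ w(0)` — the 1-D form of `B5Eq129FreeResolventWeightedMass.mul_weighted_sum_le`. [folklore]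
[cite: Balaban1984PropagatorsI, (1.29) p.23, p.36] -/
theorem cycle_weighted_mass_le (t : ℝ) {μ lam : ℝ} {w G : ZMod n → ℝ}
    (hG : ∀ s, t ^ 2 * ((G s - G (s - 1)) + (G s - G (s + 1))) + μ * G s = if s = 0 then 1 else 0) (hG0 : ∀ s, 0 ≤ G s)
    (hsup : ∀ s, lam * w s ≤ t ^ 2 * ((w s - w (s - 1)) + (w s - w (s + 1))) + μ * w s) :
    lam * ∑ s, w s * G s ≤ w 0 := by
  have hmass : ∑ s, w s * (t ^ 2 * ((G s - G (s - 1)) + (G s - G (s + 1))) + μ * G s) = w 0 := by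
    simp only [hG, mul_ite, mul_one, mul_zero, Finset.sum_ite_eq', Finset.mem_univ, if_true]
  have hswap : ∑ s, w s * (t ^ 2 * ((G s - G (s - 1)) + (G s - G (s + 1))) + μ * G s) =
      ∑ s, G s * (t ^ 2 * ((w s - w (s - 1)) + (w s - w (s + 1))) + μ * w s) := by
    have e1 : ∑ s, w s * (t ^ 2 * ((G s - G (s - 1)) + (G s - G (s + 1))) + μ * G s) =
        ∑ s, w s * (t ^ 2 * ((G s - G (s - 1)) + (G s - G (s + 1)))) + ∑ s, μ * (w s * G s) := by
      rw [← Finset.sum_add_distrib]; exact Finset.sum_congr rfl fun s _ => by ring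
    have e2 : ∑ s, G s * (t ^ 2 * ((w s - w (s - 1)) + (w s - w (s + 1))) + μ * w s) =
        ∑ s, G s * (t ^ 2 * ((w s - w (s - 1)) + (w s - w (s + 1)))) + ∑ s, μ * (w s * G s) := by
      rw [← Finset.sum_add_distrib]; exact Finset.sum_congr rfl fun s _ => by ring
    rw [e1, e2, cycle_sum_mul_stencil_comm]
  rw [← hmass, hswap, Finset.mul_sum]
  exact Finset.sum_le_sum fun s _ => by
    have := mul_le_mul_of_nonneg_left (hsup s) (hG0 s)
    linarith [this]

/-- **THE EXACT MASS OF THE CYCLE KERNEL**: `μ·Σ_s G(s) = 1` (sum the equation; the stencil sums to zero). [folklore] [cite: Balaban1984PropagatorsI, (1.29) p.23] -/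
theorem cycle_mass_eq (t : ℝ) {μ : ℝ} {G : ZMod n → ℝ}
    (hG : ∀ s, t ^ 2 * ((G s - G (s - 1)) + (G s - G (s + 1))) + μ * G s = if s = 0 then 1 else 0) :
    μ * ∑ s, G s = 1 := by
  have hsum : ∑ s, (t ^ 2 * ((G s - G (s - 1)) + (G s - G (s + 1))) + μ * G s) = 1 := by
    simp only [hG, Finset.sum_ite_eq', Finset.mem_univ, if_true]
  have hst : ∑ s : ZMod n, (1 : ℝ) * (t ^ 2 * ((G s - G (s - 1)) + (G s - G (s + 1)))) = 0 := by
    rw [cycle_sum_mul_stencil_comm]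
    simp
  rw [← hsum, ← Finset.sum_add_distrib.symm.trans rfl, Finset.mul_sum]
  simp only [one_mul] at hst
  linarith [hst]

/-- `G(0) ≤ 1∕μ` (crudely: `G ≥ 0` and the exact mass). [folklore] [cite: Balaban1984PropagatorsI, (1.29) p.23] -/
theorem mul_apply_zero_le_one (t : ℝ) {μ : ℝ} (hμ : 0 ≤ μ) {G : ZMod n → ℝ}
    (hG : ∀ s, t ^ 2 * ((G s - G (s - 1)) + (G s - G (s + 1))) + μ * G s = if s = 0 then 1 else 0) (hG0 : ∀ s, 0 ≤ G s) :
    μ * G 0 ≤ 1 := by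
  rw [← cycle_mass_eq t hG]
  exact mul_le_mul_of_nonneg_left (Finset.single_le_sum (fun s _ => hG0 s) (Finset.mem_univ 0)) hμ

/-! ## §2 The `cosh` cycle-distance weight is a supersolution; the `cosh`-weighted mass -/

/-- the distance dictionary: `circAbs n (s.val) = min(s.val, n − s.val)` (the representative `s.val ∈ [0, n)` needs no reduction; the same letter as
`B5Eq129CoshWeightFactorLetters.circAbs_val_eq_min`, kept here so that this file imports BUILT modules only). [folklore]
[cite: Balaban1984PropagatorsI, p.36 l.20–23, dictionary] -/
theorem circAbs_val_eq_min' (s : ZMod n) : ((circAbs n ((s.val : ℕ) : ℤ) : ℤ) : ℝ) = ((min s.val (n - s.val) : ℕ) : ℝ) := by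
  have hs : s.val < n := ZMod.val_lt s
  have hmod : ((s.val : ℕ) : ℤ) % (n : ℤ) = s.val := Int.emod_eq_of_lt (by positivity) (by exact_mod_cast hs)
  have h : circAbs n ((s.val : ℕ) : ℤ) = ((min s.val (n - s.val) : ℕ) : ℤ) := by
    unfold circAbs
    rw [hmod, Nat.cast_min, Nat.cast_sub hs.le]
  rw [h]; norm_cast

/-- the `cosh` cycle-distance weight `w(s) = cosh(a·min(s, n − s))` satisfies the one-step inequality `w(s+1) + w(s−1) ≤ 2cosh a·w(s)` — pv15's
`B5G183FreeRowSum.cosh_circAbs_step` on the representative `s.val`, read through the dictionary. [folklore] [cite: Balaban1984PropagatorsI, p.36] -/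
theorem cosh_cycleDist_step (a : ℝ) (s : ZMod n) :
    Real.cosh (a * ((min (s + 1).val (n - (s + 1).val) : ℕ) : ℝ)) + Real.cosh (a * ((min (s - 1).val (n - (s - 1).val) : ℕ) : ℝ)) ≤
      2 * Real.cosh a * Real.cosh (a * ((min s.val (n - s.val) : ℕ) : ℝ)) := by
  have hP : 1 ≤ n := Nat.one_le_iff_ne_zero.mpr (NeZero.ne _)
  have e1 : circAbs n (((s + 1).val : ℕ) : ℤ) = circAbs n (((s.val : ℕ) : ℤ) + 1) :=
    circAbs_val_eq _ _ (by push_cast; rw [ZMod.natCast_zmod_val])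
  have e2 : circAbs n (((s - 1).val : ℕ) : ℤ) = circAbs n (((s.val : ℕ) : ℤ) - 1) :=
    circAbs_val_eq _ _ (by push_cast; rw [ZMod.natCast_zmod_val])
  rw [← circAbs_val_eq_min' (s + 1), ← circAbs_val_eq_min' (s - 1), ← circAbs_val_eq_min' s, e1, e2]
  exact cosh_circAbs_step hP a _

/-- **THE `cosh` CYCLE-DISTANCE WEIGHT IS A SUPERSOLUTION, SECOND ORDER IN THE RATE**: with `λ₁ = μ − 2t²(cosh a − 1)`,
`λ₁·w(s) ≤ t²[(w s − w(s−1)) + (w s − w(s+1))] + μ·w(s)` for `w(s) = cosh(a·min(s, n−s))` — the 1-D form of `B5Eq129CoshSupersolution.weight_supersolution`.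
[folklore] [cite: Balaban1984PropagatorsI, p.36] -/
theorem cosh_cycleDist_supersolution (a t μ : ℝ) (s : ZMod n) :
    (μ - 2 * t ^ 2 * (Real.cosh a - 1)) * Real.cosh (a * ((min s.val (n - s.val) : ℕ) : ℝ)) ≤
      t ^ 2 * ((Real.cosh (a * ((min s.val (n - s.val) : ℕ) : ℝ)) - Real.cosh (a * ((min (s - 1).val (n - (s - 1).val) : ℕ) : ℝ))) +
          (Real.cosh (a * ((min s.val (n - s.val) : ℕ) : ℝ)) - Real.cosh (a * ((min (s + 1).val (n - (s + 1).val) : ℕ) : ℝ)))) +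
        μ * Real.cosh (a * ((min s.val (n - s.val) : ℕ) : ℝ)) := by
  have h := cosh_cycleDist_step a s
  have ht : 0 ≤ t ^ 2 := sq_nonneg t
  nlinarith [mul_le_mul_of_nonneg_left h ht]

/-- **THE `cosh`-WEIGHTED MASS OF THE CYCLE KERNEL**: `(μ − 2t²(cosh a − 1))·Σ_s cosh(a·min(s, n−s))·G(s) ≤ 1`. [folklore]
[cite: Balaban1984PropagatorsI, (1.29) p.23, p.36] -/
theorem cosh_weighted_mass_le (a t : ℝ) {μ : ℝ} {G : ZMod n → ℝ}
    (hG : ∀ s, t ^ 2 * ((G s - G (s - 1)) + (G s - G (s + 1))) + μ * G s = if s = 0 then 1 else 0) (hG0 : ∀ s, 0 ≤ G s) :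
    (μ - 2 * t ^ 2 * (Real.cosh a - 1)) * ∑ s, Real.cosh (a * ((min s.val (n - s.val) : ℕ) : ℝ)) * G s ≤ 1 := by
  have h := cycle_weighted_mass_le t hG hG0 (fun s => cosh_cycleDist_supersolution a t μ s)
  simpa [ZMod.val_zero] using h

/-! ## §3 The V-fold: the half-range sum against `G(j)` is half the cycle sum against `G` off the source -/

omit [NeZero n] in
/-- for `1 ≤ j < ⌊n∕2⌋`: `(j : ZMod n).val = j`. [folklore] -/
private theorem val_cast_of_mem_Ico {j : ℕ} (hj : j ∈ Finset.Ico 1 (n / 2)) : ((j : ZMod n)).val = j := by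
  rw [Finset.mem_Ico] at hj
  exact ZMod.val_natCast_of_lt (by omega)

/-- for `1 ≤ j < ⌊n∕2⌋`: `(−(j : ZMod n)).val = n − j`. [folklore] -/
private theorem val_neg_cast_of_mem_Ico {j : ℕ} (hj : j ∈ Finset.Ico 1 (n / 2)) : (-(j : ZMod n)).val = n - j := by
  have hv := val_cast_of_mem_Ico hj
  rw [Finset.mem_Ico] at hj
  have hne : (j : ZMod n) ≠ 0 := fun h => by rw [h, ZMod.val_zero] at hv; omega
  rw [ZMod.neg_val, if_neg hne, hv]

/-- **THE V-FOLD**: for `g ≥ 0` on `ℕ` and `G ≥ 0` even on `ℤ∕n` (`n ≥ 2`),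
`2·Σ_{j ∈ Ico 1 (n∕2)} g(j)·G(j) ≤ Σ_{s ∈ univ.erase 0} g(min(s, n − s))·G(s)` — the images `j ↦ j` and `j ↦ −j` of `[1, ⌊n∕2⌋)` are disjoint subsets of
`ℤ∕n ∖ {0}` on which `min(s, n−s) = j`. [folklore] [cite: Balaban1984PropagatorsI, (1.29) p.23] -/
theorem two_mul_sum_Ico_le (g : ℕ → ℝ) (hg : ∀ j, 0 ≤ g j) {G : ZMod n → ℝ} (hG0 : ∀ s, 0 ≤ G s) (hGeven : ∀ s, G (-s) = G s) :
    2 * ∑ j ∈ Finset.Ico 1 (n / 2), g j * G (j : ZMod n) ≤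
      ∑ s ∈ Finset.univ.erase (0 : ZMod n), g (min s.val (n - s.val)) * G s := by
  classical
  set I := Finset.Ico 1 (n / 2) with hI
  set Sp : Finset (ZMod n) := I.image (fun j : ℕ => (j : ZMod n)) with hSp
  set Sm : Finset (ZMod n) := I.image (fun j : ℕ => -(j : ZMod n)) with hSm
  -- injectivity on `I`
  have hinjp : Set.InjOn (fun j : ℕ => (j : ZMod n)) I := by
    intro j hj j' hj' h
    have e := congrArg ZMod.val h
    simp only at e
    rwa [val_cast_of_mem_Ico (by exact_mod_cast hj), val_cast_of_mem_Ico (by exact_mod_cast hj')] at e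
  have hinjm : Set.InjOn (fun j : ℕ => -(j : ZMod n)) I := by
    intro j hj j' hj' h
    have h' : (j : ZMod n) = (j' : ZMod n) := neg_injective h
    exact hinjp hj hj' h'
  -- the min on the images
  have hminp : ∀ j ∈ I, min ((j : ZMod n)).val (n - ((j : ZMod n)).val) = j := by
    intro j hj
    rw [val_cast_of_mem_Ico hj]
    rw [hI, Finset.mem_Ico] at hj
    exact min_eq_left (by omega)
  have hminm : ∀ j ∈ I, min (-(j : ZMod n)).val (n - (-(j : ZMod n)).val) = j := by
    intro j hj
    rw [val_neg_cast_of_mem_Ico hj]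
    rw [hI, Finset.mem_Ico] at hj
    rw [Nat.sub_sub_self (by omega)]
    exact min_eq_right (by omega)
  -- the two copies of the half-range sum
  have hp : ∑ j ∈ I, g j * G (j : ZMod n) = ∑ s ∈ Sp, g (min s.val (n - s.val)) * G s := by
    rw [hSp, Finset.sum_image hinjp]
    exact Finset.sum_congr rfl fun j hj => by rw [hminp j hj]
  have hm : ∑ j ∈ I, g j * G (j : ZMod n) = ∑ s ∈ Sm, g (min s.val (n - s.val)) * G s := by
    rw [hSm, Finset.sum_image hinjm]
    exact Finset.sum_congr rfl fun j hj => by rw [hminm j hj, hGeven]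
  -- disjointness and support off the source
  have hdisj : Disjoint Sp Sm := by
    rw [hSp, hSm, Finset.disjoint_left]
    intro s hs hs'
    rw [Finset.mem_image] at hs hs'
    obtain ⟨j, hj, rfl⟩ := hs
    obtain ⟨j', hj', hjj'⟩ := hs'
    have hsum : ((j + j' : ℕ) : ZMod n) = 0 := by push_cast; rw [← hjj']; ring
    rw [ZMod.natCast_eq_zero_iff] at hsum
    rw [hI, Finset.mem_Ico] at hj hj'
    have : n ≤ j + j' := Nat.le_of_dvd (by omega) hsum
    omega
  have hsub : Sp ∪ Sm ⊆ Finset.univ.erase (0 : ZMod n) := by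
    intro s hs
    rw [Finset.mem_erase]
    refine ⟨?_, Finset.mem_univ _⟩
    rw [Finset.mem_union, hSp, hSm, Finset.mem_image, Finset.mem_image] at hs
    rcases hs with ⟨j, hj, rfl⟩ | ⟨j, hj, rfl⟩
    · intro h
      have hv := val_cast_of_mem_Ico hj
      rw [h, ZMod.val_zero] at hv
      rw [hI, Finset.mem_Ico] at hj
      omega
    · intro h
      have hv := val_neg_cast_of_mem_Ico hj
      rw [h, ZMod.val_zero] at hv
      rw [hI, Finset.mem_Ico] at hj
      omega
  calc 2 * ∑ j ∈ I, g j * G (j : ZMod n)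
      = ∑ s ∈ Sp, g (min s.val (n - s.val)) * G s + ∑ s ∈ Sm, g (min s.val (n - s.val)) * G s := by rw [two_mul, ← hp, ← hm]
    _ = ∑ s ∈ Sp ∪ Sm, g (min s.val (n - s.val)) * G s := (Finset.sum_union hdisj).symm
    _ ≤ ∑ s ∈ Finset.univ.erase (0 : ZMod n), g (min s.val (n - s.val)) * G s :=
        Finset.sum_le_sum_of_subset_of_nonneg hsub fun s _ _ => mul_nonneg (hg _) (hG0 s)

/-! ## §4 The two brackets of the weighted ∇-row, uniformly in the period -/

/-- **THE (W-0) BRACKET FOLDED**: for `a ≥ 0`, `G ≥ 0` even,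
`(1 + cosh a)G(0) + 2 sinh a·Σ_{1≤j<⌊n∕2⌋} sinh(aj)G(j) ≤ (1 + e^{−a})G(0) + sinh a·Σ_s cosh(a·min(s, n−s))G(s)` (`sinh ≤ cosh`, `1 + cosh a − sinh a = 1 + e^{−a}`).
[folklore] [cite: Balaban1984PropagatorsI, (1.29) p.23, p.36] -/
theorem cosh_bracket_le {a : ℝ} (ha : 0 ≤ a) {G : ZMod n → ℝ} (hG0 : ∀ s, 0 ≤ G s) (hGeven : ∀ s, G (-s) = G s) :
    (1 + Real.cosh a) * G 0 + 2 * Real.sinh a * ∑ j ∈ Finset.Ico 1 (n / 2), Real.sinh (a * j) * G (j : ZMod n) ≤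
      (1 + Real.exp (-a)) * G 0 + Real.sinh a * ∑ s, Real.cosh (a * ((min s.val (n - s.val) : ℕ) : ℝ)) * G s := by
  classical
  have hsa : 0 ≤ Real.sinh a := Real.sinh_nonneg_iff.mpr ha
  have hfold := two_mul_sum_Ico_le (fun j : ℕ => Real.sinh (a * j)) (fun j => Real.sinh_nonneg_iff.mpr (by positivity)) hG0 hGeven
  have hcmp : ∑ s ∈ Finset.univ.erase (0 : ZMod n), Real.sinh (a * ((min s.val (n - s.val) : ℕ) : ℝ)) * G s ≤
      ∑ s ∈ Finset.univ.erase (0 : ZMod n), Real.cosh (a * ((min s.val (n - s.val) : ℕ) : ℝ)) * G s :=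
    Finset.sum_le_sum fun s _ => mul_le_mul_of_nonneg_right (Real.sinh_lt_cosh _).le (hG0 s)
  have hsplit : ∑ s, Real.cosh (a * ((min s.val (n - s.val) : ℕ) : ℝ)) * G s =
      G 0 + ∑ s ∈ Finset.univ.erase (0 : ZMod n), Real.cosh (a * ((min s.val (n - s.val) : ℕ) : ℝ)) * G s := by
    rw [← Finset.add_sum_erase _ _ (Finset.mem_univ (0 : ZMod n))]
    simp [ZMod.val_zero]
  have hexp : 1 + Real.cosh a - Real.sinh a = 1 + Real.exp (-a) := by
    rw [Real.cosh_eq, Real.sinh_eq]; ring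
  have hfold' : 2 * Real.sinh a * ∑ j ∈ Finset.Ico 1 (n / 2), Real.sinh (a * j) * G (j : ZMod n) ≤
      Real.sinh a * ∑ s ∈ Finset.univ.erase (0 : ZMod n), Real.cosh (a * ((min s.val (n - s.val) : ℕ) : ℝ)) * G s := by
    have := mul_le_mul_of_nonneg_left (hfold.trans hcmp) hsa
    linarith [this]
  rw [hsplit, ← hexp]
  nlinarith [hfold', hG0 0]

/-- **THE (W-1) BRACKET FOLDED**: for `a ≥ 0`, `G ≥ 0` even,
`(1 + e^a)G(0) + 2 sinh a·Σ_{1≤j<⌊n∕2⌋} e^{aj}G(j) ≤ (1 + e^{−a})G(0) + 2 sinh a·Σ_s cosh(a·min(s, n−s))G(s)` (`e^x ≤ 2cosh x`, `1 + e^a − 2 sinh a = 1 + e^{−a}`).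
[folklore] [cite: Balaban1984PropagatorsI, (1.29) p.23, p.36] -/
theorem exp_bracket_le {a : ℝ} (ha : 0 ≤ a) {G : ZMod n → ℝ} (hG0 : ∀ s, 0 ≤ G s) (hGeven : ∀ s, G (-s) = G s) :
    (1 + Real.exp a) * G 0 + 2 * Real.sinh a * ∑ j ∈ Finset.Ico 1 (n / 2), Real.exp (a * j) * G (j : ZMod n) ≤
      (1 + Real.exp (-a)) * G 0 + 2 * Real.sinh a * ∑ s, Real.cosh (a * ((min s.val (n - s.val) : ℕ) : ℝ)) * G s := by
  classical
  have hsa : 0 ≤ Real.sinh a := Real.sinh_nonneg_iff.mpr ha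
  have hfold := two_mul_sum_Ico_le (fun j : ℕ => Real.exp (a * j)) (fun j => (Real.exp_pos _).le) hG0 hGeven
  have hcmp : ∑ s ∈ Finset.univ.erase (0 : ZMod n), Real.exp (a * ((min s.val (n - s.val) : ℕ) : ℝ)) * G s ≤
      ∑ s ∈ Finset.univ.erase (0 : ZMod n), 2 * (Real.cosh (a * ((min s.val (n - s.val) : ℕ) : ℝ)) * G s) :=
    Finset.sum_le_sum fun s _ => by
      rw [← mul_assoc]
      refine mul_le_mul_of_nonneg_right ?_ (hG0 s)
      rw [Real.cosh_eq]
      linarith [Real.exp_pos (-(a * ((min s.val (n - s.val) : ℕ) : ℝ)))]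
  have hsplit : ∑ s, Real.cosh (a * ((min s.val (n - s.val) : ℕ) : ℝ)) * G s =
      G 0 + ∑ s ∈ Finset.univ.erase (0 : ZMod n), Real.cosh (a * ((min s.val (n - s.val) : ℕ) : ℝ)) * G s := by
    rw [← Finset.add_sum_erase _ _ (Finset.mem_univ (0 : ZMod n))]
    simp [ZMod.val_zero]
  have hexp : 1 + Real.exp a - 2 * Real.sinh a = 1 + Real.exp (-a) := by
    rw [Real.sinh_eq]; ring
  have hfold' : 2 * Real.sinh a * ∑ j ∈ Finset.Ico 1 (n / 2), Real.exp (a * j) * G (j : ZMod n) ≤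
      2 * Real.sinh a * ∑ s ∈ Finset.univ.erase (0 : ZMod n), Real.cosh (a * ((min s.val (n - s.val) : ℕ) : ℝ)) * G s := by
    have h2 := hfold.trans hcmp
    rw [← Finset.mul_sum] at h2
    have := mul_le_mul_of_nonneg_left h2 hsa
    linarith [this]
  rw [hsplit, ← hexp]
  nlinarith [hfold', hG0 0]

/-- **THE (W-0) BRACKET, UNIFORMLY IN THE PERIOD**: in the rate window `2t²(cosh a − 1) < μ`,
`(1 + cosh a)G(0) + 2 sinh a·Σ_{1≤j<⌊n∕2⌋} sinh(aj)G(j) ≤ (1 + e^{−a})G(0) + sinh a ∕ (μ − 2t²(cosh a − 1))` — at the transversally shifted mass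
`μ = m − 2(d−1)t²(cosh a − 1)` of `B5Eq129FreeResolventWeightedGradientRowCosh` the denominator is the OWNER's `λ = m − 2d·t²(cosh a − 1)`.
[folklore] [cite: Balaban1984PropagatorsI, (1.29) p.23, p.36] -/
theorem cosh_bracket_le_uniform (t : ℝ) {μ a : ℝ} (ha : 0 ≤ a) (hlam : 2 * t ^ 2 * (Real.cosh a - 1) < μ) {G : ZMod n → ℝ}
    (hG : ∀ s, t ^ 2 * ((G s - G (s - 1)) + (G s - G (s + 1))) + μ * G s = if s = 0 then 1 else 0) (hG0 : ∀ s, 0 ≤ G s)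
    (hGeven : ∀ s, G (-s) = G s) :
    (1 + Real.cosh a) * G 0 + 2 * Real.sinh a * ∑ j ∈ Finset.Ico 1 (n / 2), Real.sinh (a * j) * G (j : ZMod n) ≤
      (1 + Real.exp (-a)) * G 0 + Real.sinh a / (μ - 2 * t ^ 2 * (Real.cosh a - 1)) := by
  have hlam' : 0 < μ - 2 * t ^ 2 * (Real.cosh a - 1) := by linarith
  have hmass := cosh_weighted_mass_le a t hG hG0
  have hS : ∑ s, Real.cosh (a * ((min s.val (n - s.val) : ℕ) : ℝ)) * G s ≤ 1 / (μ - 2 * t ^ 2 * (Real.cosh a - 1)) := by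
    rw [le_div_iff₀ hlam', mul_comm]; exact hmass
  have hsa : 0 ≤ Real.sinh a := Real.sinh_nonneg_iff.mpr ha
  calc _ ≤ (1 + Real.exp (-a)) * G 0 + Real.sinh a * ∑ s, Real.cosh (a * ((min s.val (n - s.val) : ℕ) : ℝ)) * G s :=
        cosh_bracket_le ha hG0 hGeven
    _ ≤ (1 + Real.exp (-a)) * G 0 + Real.sinh a * (1 / (μ - 2 * t ^ 2 * (Real.cosh a - 1))) := by
        have := mul_le_mul_of_nonneg_left hS hsa
        linarith
    _ = _ := by rw [mul_one_div]

/-- **THE (W-1) BRACKET, UNIFORMLY IN THE PERIOD**: in the rate window `2t²(cosh a − 1) < μ`,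
`(1 + e^a)G(0) + 2 sinh a·Σ_{1≤j<⌊n∕2⌋} e^{aj}G(j) ≤ (1 + e^{−a})G(0) + 2 sinh a ∕ (μ − 2t²(cosh a − 1))`. [folklore] [cite: Balaban1984PropagatorsI, (1.29) p.23, p.36] -/
theorem exp_bracket_le_uniform (t : ℝ) {μ a : ℝ} (ha : 0 ≤ a) (hlam : 2 * t ^ 2 * (Real.cosh a - 1) < μ) {G : ZMod n → ℝ}
    (hG : ∀ s, t ^ 2 * ((G s - G (s - 1)) + (G s - G (s + 1))) + μ * G s = if s = 0 then 1 else 0) (hG0 : ∀ s, 0 ≤ G s)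
    (hGeven : ∀ s, G (-s) = G s) :
    (1 + Real.exp a) * G 0 + 2 * Real.sinh a * ∑ j ∈ Finset.Ico 1 (n / 2), Real.exp (a * j) * G (j : ZMod n) ≤
      (1 + Real.exp (-a)) * G 0 + 2 * Real.sinh a / (μ - 2 * t ^ 2 * (Real.cosh a - 1)) := by
  have hlam' : 0 < μ - 2 * t ^ 2 * (Real.cosh a - 1) := by linarith
  have hmass := cosh_weighted_mass_le a t hG hG0
  have hS : ∑ s, Real.cosh (a * ((min s.val (n - s.val) : ℕ) : ℝ)) * G s ≤ 1 / (μ - 2 * t ^ 2 * (Real.cosh a - 1)) := by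
    rw [le_div_iff₀ hlam', mul_comm]; exact hmass
  have hsa : 0 ≤ 2 * Real.sinh a := by have := Real.sinh_nonneg_iff.mpr ha; linarith
  calc _ ≤ (1 + Real.exp (-a)) * G 0 + 2 * Real.sinh a * ∑ s, Real.cosh (a * ((min s.val (n - s.val) : ℕ) : ℝ)) * G s :=
        exp_bracket_le ha hG0 hGeven
    _ ≤ (1 + Real.exp (-a)) * G 0 + 2 * Real.sinh a * (1 / (μ - 2 * t ^ 2 * (Real.cosh a - 1))) := by
        have := mul_le_mul_of_nonneg_left hS hsa
        linarith
    _ = _ := by rw [mul_one_div]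

end Literature.MathematicalPhysics.QuantumFieldTheory.Balaban1983to89.B5Eq129CycleWeightedMass

end
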